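import Literature.NumberTheory.EllipticCurves.Rank1Residual.Typed.X5DescentSelmerLevel3
import Literature.NumberTheory.EllipticCurves.Rank1Residual.Typed.X5DescentPairing
import HarnessLib

/-!
# X5 (p = 2): the level-3 datum in ITEM / PAIRING-BIT form (what ONE computation would certify)

Support file for the BSD rank-≤ 1 residual programme, class X5 (`p = 2`), unit `b2b-bsdres-sha-1`
(gen 6). Honest framing: prove what is provable now; shrink each hard class to its core with data;
no claim beyond stated classes. Everything here is proved; the named facts entering are
Gross–Zagier–Kolyvagin (`hGZK`) and, for the witness / Selmer forms, the Cassels–Tate pairing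
bsd.S18 (`hCT`, tree `WeierstrassCurve.exists_casselsTate_pairing`).

`X5DescentSelmerLevel3` types the input missing on the census's two LOWER-BOUND-ONLY curves
(19074h1, 19074h2: `#Ш_an = 64`, `#Ш[2] = 4`, `Ш[2] ⊆ 2Ш`, `Ш[4] ⊆ 2Ш` certified; `Ш[16] = Ш[8]`
not) as MODE S at levels `8 | 16` — a statement about EVERY `s ∈ Sel^(8)(E/ℚ)` with `4·π₈(s) ≠ 0`.
This file records that, exactly as at level 2 (`X5DescentPairing`, `X5DescentItem`), ONE item
suffices and the statement is structure-free:

* `stable_eight_of_pairing_bit` — for ANY alternating bi-additive `B` on an abelian group `A` with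
  `#A[2] = 4` and `A[4] ⊆ 2A`: ONE pair `x ∈ A[8]`, `y ∈ A[2]` with `B x y ≠ 0` forces
  `A[16] = A[8]` (four-element case analysis in `A[2]`; no structure theorem, no non-degeneracy);
* `X5.bsdp_two_of_pairing_bit₈` — `BSD(E, 2)` from that one bit, the level-2 count/lifting lines
  and `ord₂ #Ш_an = 6`, granted GZK (the shape a Cassels–Tate evaluation on `Sel^(8) × Sel^(2)`
  would certify with a single value `½`);
* `X5.bsdp_two_of_casselsTate_witness₈` — the same from ONE `x ∈ Ш[8]` that is not twice an
  element of `Ш` (bsd.S18 supplies the `y`);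
* `X5.not_two_divisible_of_not_mem_selmer16`, `X5.bsdp_two_of_selmer_item₈` — the same over the
  tree's Selmer groups: ONE `s ∈ Sel^(8)(E/ℚ)` outside `[2]_* Sel^(16)(E/ℚ)` (Kummer–Selmer diagram
  at levels `8 | 16`: `π₈ ∘ [2]_* = 2·π₁₆`, `Sel^(16) ↠ Ш[16]`, `ker π₈ ⊆ [2]_* Sel^(16)`).

Nothing here is claimed for 19074h1/h2: the hypothesis `hbit` / `hx` / `hs` is precisely what
remains OPEN for them. In the 2-isogeny descent tower of [Fisher, arXiv:1509.03234, Thm. 2.1 and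
§5] this bit is the first pairing value not forced to vanish by `#Ш(E)[2] = #Ш(E')[2] = 4` on the
isogenous pair — two steps beyond the pairings computed there (loc. cit. p. 18); no published
algorithm evaluates it (unit notes, gen 6).

References: Silverman, *AEC* (2009), Thm. X.4.2, Thm. X.4.14; Cassels (1962), Arithmetic IV;
Cassels (1998), §1; Stamminger (2005), §1.3 and Thm. 6.2.2; Fisher, arXiv:1509.03234.
-/

noncomputable section

open scoped Classical
open scoped AddSubgroup

open WeierstrassCurve Literature.NumberTheory.EllipticCurves
  Literature.NumberTheory.EllipticCurves.Rank1Residual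
  Literature.GroupTheory.FiniteAbelian

namespace Literature.NumberTheory.EllipticCurves.Rank1Residual.Typed

/-! ### §1 Algebra: one pairing bit at level `(8, 2)` is `A[16] = A[8]` -/

section Algebra

variable {A : Type*} [AddCommGroup A] {Q : Type*} [AddCommGroup Q] (B : A →+ A →+ Q)

/-- **A non-zero pairing value against `A[2]` obstructs `2`-divisibility** (bilinearity only):
`B (2w) y = B w (2y) = 0`. [cite: SilvermanAEC2009, Thm. X.4.14 (bilinearity only)] -/
theorem not_two_divisible_of_pairing_bit {x y : A} (hy : 2 • y = 0) (hB : B x y ≠ 0) :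
    ¬ ∃ w : A, 2 • w = x := by
  rintro ⟨w, rfl⟩
  apply hB
  rw [map_nsmul, AddMonoidHom.nsmul_apply, ← map_nsmul, hy, map_zero]

/-- An additive map that kills two distinct non-zero elements of a FOUR-element `A[2]` kills
`A[2]` (the third non-zero element is their sum). Private helper (finite case analysis).
[folklore] -/
private theorem eq_zero_on_torsionBy_two (hcard : Nat.card (A[(2 : ℕ)]) = 4) (f : A →+ Q)
    {a b : A} (ha : 2 • a = 0) (hb : 2 • b = 0) (ha0 : a ≠ 0) (hb0 : b ≠ 0) (hab : a ≠ b)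
    (hfa : f a = 0) (hfb : f b = 0) : ∀ v : A, 2 • v = 0 → f v = 0 := by
  intro v hv
  haveI : Finite (A[(2 : ℕ)]) := Nat.finite_of_card_ne_zero (by rw [hcard]; norm_num)
  haveI : Fintype (A[(2 : ℕ)]) := Fintype.ofFinite _
  have hmem : ∀ {x : A}, 2 • x = 0 → x ∈ A[(2 : ℕ)] := fun hx => AddSubgroup.torsionBy.nsmul_iff.2 hx
  let a' : A[(2 : ℕ)] := ⟨a, hmem ha⟩
  let b' : A[(2 : ℕ)] := ⟨b, hmem hb⟩
  let v' : A[(2 : ℕ)] := ⟨v, hmem hv⟩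
  have hab' : a' + b' = ⟨a + b, hmem (by rw [smul_add, ha, hb, add_zero])⟩ := rfl
  have hnegb : -b = b := by
    rw [neg_eq_iff_add_eq_zero, ← two_nsmul]; exact hb
  have h1 : a + b ≠ 0 := by
    intro h; apply hab; rw [add_eq_zero_iff_eq_neg.1 h, hnegb]
  have h2 : a + b ≠ a := by
    intro h; exact hb0 (by simpa using h)
  have h3 : a + b ≠ b := by
    intro h; exact ha0 (by simpa using h)
  -- the four-element finset `{0, a, b, a + b}` is all of `A[2]`
  let S : Finset (A[(2 : ℕ)]) := {0, a', b', a' + b'}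
  have hS : S.card = 4 := by
    have e0a : (0 : A[(2 : ℕ)]) ≠ a' := fun h => ha0 (congrArg Subtype.val h).symm
    have e0b : (0 : A[(2 : ℕ)]) ≠ b' := fun h => hb0 (congrArg Subtype.val h).symm
    have e0c : (0 : A[(2 : ℕ)]) ≠ a' + b' := fun h =>
      h1 (by rw [hab'] at h; exact (congrArg Subtype.val h).symm)
    have eab : a' ≠ b' := fun h => hab (congrArg Subtype.val h)
    have eac : a' ≠ a' + b' := fun h =>
      h2 (by rw [hab'] at h; exact (congrArg Subtype.val h).symm)
    have ebc : b' ≠ a' + b' := fun h =>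
      h3 (by rw [hab'] at h; exact (congrArg Subtype.val h).symm)
    simp only [S]
    rw [Finset.card_insert_of_notMem, Finset.card_insert_of_notMem, Finset.card_insert_of_notMem,
      Finset.card_singleton]
    · simpa using ebc
    · simp only [Finset.mem_insert, Finset.mem_singleton, not_or]; exact ⟨eab, eac⟩
    · simp only [Finset.mem_insert, Finset.mem_singleton, not_or]; exact ⟨e0a, e0b, e0c⟩
  have hcard' : Fintype.card (A[(2 : ℕ)]) = 4 := by rw [← Nat.card_eq_fintype_card, hcard]
  have hSuniv : S = Finset.univ := Finset.eq_univ_of_card S (by rw [hS, hcard'])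
  have hvS : v' ∈ S := by rw [hSuniv]; exact Finset.mem_univ _
  simp only [S, Finset.mem_insert, Finset.mem_singleton] at hvS
  have hfab : f (a + b) = 0 := by rw [map_add, hfa, hfb, add_zero]
  rcases hvS with h | h | h | h
  · have hv0 : v = 0 := by simpa [v'] using congrArg Subtype.val h
    rw [hv0, map_zero]
  · have hva : v = a := by simpa [v', a'] using congrArg Subtype.val h
    rw [hva, hfa]
  · have hvb : v = b := by simpa [v', b'] using congrArg Subtype.val h
    rw [hvb, hfb]
  · have hvab : v = a + b := by rw [hab'] at h; simpa [v'] using congrArg Subtype.val h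
    rw [hvab, hfab]

/-- **ONE pairing bit at level `(8, 2)` IS `A[16] = A[8]`, structure-free.** For ANY alternating
bi-additive `B : A × A → Q`: if `#A[2] = 4`, every element of `A[4]` is twice an element (`hdiv₄`,
the `8`-descent lifting line), and ONE `x ∈ A[8]` pairs non-trivially with ONE `y ∈ A[2]`, then
`16z = 0 ⇒ 8z = 0`. Proof: `x ∉ 2A` (bilinearity), so `4x ≠ 0`; if `8z ≠ 0` then either `4x = 8z`,
whence `x - 2z ∈ A[4] ⊆ 2A` and `x ∈ 2A`; or `4x, 8z` are distinct non-zero elements of the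
four-element `A[2]` both killed by `B x` (`B x (4x) = 4·B x x = 0`, `B x (8z) = B (8x) z = 0`), so
`B x` kills `A[2] ∋ y`. The level-`(4, 2)` analogue is `stable_four_of_pairing_bits`.
[cite: SilvermanAEC2009, Thm. X.4.14 (bilinear, alternating)] [cite: Cassels1998, §1] -/
theorem stable_eight_of_pairing_bit (halt : ∀ x : A, B x x = 0)
    (hcard : Nat.card (A[(2 : ℕ)]) = 4) (hdiv₄ : ∀ y : A, 4 • y = 0 → ∃ x : A, 2 • x = y)
    (hbit : ∃ x y : A, 8 • x = 0 ∧ 2 • y = 0 ∧ B x y ≠ 0) :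
    ∀ z : A, 16 • z = 0 → 8 • z = 0 := by
  obtain ⟨x, y, hx, hy, hB⟩ := hbit
  have hx2 : ¬ ∃ u : A, 2 • u = x := not_two_divisible_of_pairing_bit B hy hB
  have h4x : 4 • x ≠ 0 := fun h => hx2 (hdiv₄ x h)
  intro z hz
  by_contra h8
  by_cases hxw : 4 • x = 8 • z
  · -- `x - 2z ∈ A[4] ⊆ 2A`, so `x ∈ 2A`
    have h4 : 4 • (x - 2 • z) = 0 := by
      rw [smul_sub, hxw, smul_smul]
      norm_num
    obtain ⟨u, hu⟩ := hdiv₄ _ h4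
    exact hx2 ⟨u + z, by rw [smul_add, hu, sub_add_cancel]⟩
  · -- `4x ≠ 8z`, both non-zero in the four-element `A[2]`, both killed by `B x`
    have h2a : 2 • (4 • x) = 0 := by rw [smul_smul]; exact hx
    have h2b : 2 • (8 • z) = 0 := by rw [smul_smul]; exact hz
    have hBa : B x (4 • x) = 0 := by rw [map_nsmul, halt, smul_zero]
    have hBb : B x (8 • z) = 0 := by
      have e : B x (8 • z) = B (8 • x) z := by
        simp only [map_nsmul, AddMonoidHom.nsmul_apply]
      rw [e, hx, map_zero, AddMonoidHom.zero_apply]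
    exact hB (eq_zero_on_torsionBy_two hcard (B x) h2a h2b h4x h8 hxw hBa hBb y hy)

/-- **Witness form**: with the ORTHOGONALITY property (`horth`: an element pairing trivially with
`A[2]` is twice an element — the Cassels–Tate kernel property on a finite `Ш`), ONE `x ∈ A[8]` that
is not twice an element gives the bit, hence `A[16] = A[8]`.
[cite: SilvermanAEC2009, Thm. X.4.14] [cite: Cassels1962ArithmeticIV, Thm. 1.1] -/
theorem stable_eight_of_witness (halt : ∀ x : A, B x x = 0)
    (horth : ∀ x : A, (∀ y : A, 2 • y = 0 → B x y = 0) → ∃ w : A, 2 • w = x)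
    (hcard : Nat.card (A[(2 : ℕ)]) = 4) (hdiv₄ : ∀ y : A, 4 • y = 0 → ∃ x : A, 2 • x = y)
    (hx : ∃ x : A, 8 • x = 0 ∧ ¬ ∃ w : A, 2 • w = x) :
    ∀ z : A, 16 • z = 0 → 8 • z = 0 := by
  obtain ⟨x, hx8, hx2⟩ := hx
  refine stable_eight_of_pairing_bit B halt hcard hdiv₄ ?_
  by_contra h
  exact hx2 (horth x fun y hy => Classical.by_contradiction fun hB => h ⟨x, y, hx8, hy, hB⟩)

end Algebra

/-! ### §2 `Ш(E/ℚ)`: the X5 consumers at level 3 -/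

section Sha

variable (W : WeierstrassCurve ℚ) [W.IsElliptic] [W.IsGloballyMinimal]

/-- **X5, level 3, pairing-bit shape (structure-free): `BSD(E, 2)` from ONE bit.** GZK (`hGZK`),
`r_an ≤ 1`; ANY alternating bi-additive `B` on `Ш(E/ℚ)` (e.g. the Cassels–Tate pairing evaluated
on `Sel^(8) × Sel^(2)`) with ONE `x ∈ Ш[8]`, `y ∈ Ш[2]`, `B x y ≠ 0`; `#Ш[2] = 4`, `Ш[2] ⊆ 2Ш`
(`#Ш[4] = 16`), `Ш[4] ⊆ 2Ш` (`#Ш[8] = 64`); `ord₂ #Ш_an = 6`. Nothing is claimed for any curve.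
[cite: SilvermanAEC2009, Thm. X.4.2(a), Thm. X.4.14] [cite: Cassels1998, §1] [cite: Miller2011LMS, Def. 1.1] -/
theorem X5.bsdp_two_of_pairing_bit₈ (hGZK : rank_eq_analyticRank_of_analyticRank_le_one)
    (hr : W.analyticRank ≤ 1) {Q : Type*} [AddCommGroup Q] (B : W.sha →+ W.sha →+ Q)
    (halt : ∀ x : W.sha, B x x = 0)
    (h2 : Nat.card (AddSubgroup.torsionBy W.sha 2) = 4)
    (hdiv : ∀ z : W.sha, 2 • z = 0 → ∃ w : W.sha, 2 • w = z)
    (hdiv₄ : ∀ y : W.sha, 4 • y = 0 → ∃ x : W.sha, 2 • x = y)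
    (hbit : ∃ x y : W.sha, 8 • x = 0 ∧ 2 • y = 0 ∧ B x y ≠ 0)
    {q : ℚ} (hq : shaAn W = (q : ℂ)) (hv : padicValRat 2 q = 6) : BSDp W 2 := by
  have h4 := X5.card_sha_four_eq_sixteen W h2 hdiv
  have h8 : Nat.card (AddSubgroup.torsionBy W.sha 8) = 2 ^ 6 := by
    rw [card_torsionBy_eight_of_two_divisible_four h2 h4 hdiv₄]; norm_num
  exact X5.bsdp_two_of_descentCertificateAt W hGZK hr
    (X5.descentCertificateAt_of_level_three W
      (stable_eight_of_pairing_bit B halt (by simpa using h2) hdiv₄ hbit) h8 hq (by exact_mod_cast hv))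

/-- **X5, level 3, witness shape: `BSD(E, 2)` from ONE non-divisible element of `Ш[8]` and
bsd.S18.** GZK (`hGZK`: `Ш` finite), the Cassels–Tate named fact (`hCT`), `r_an ≤ 1`; `#Ш[2] = 4`,
`Ш[2] ⊆ 2Ш`, `Ш[4] ⊆ 2Ш`; ONE `x ∈ Ш[8]` that is not twice an element of `Ш`; `ord₂ #Ш_an = 6`.
(Then `x` has exact order `8`: elements of `Ш[4]` are divisible by `hdiv₄`.) Nothing is claimed for
any curve. [cite: SilvermanAEC2009, Thm. X.4.14] [cite: Cassels1962ArithmeticIV, Thm. 1.1] [cite: Miller2011LMS, Def. 1.1] -/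
theorem X5.bsdp_two_of_casselsTate_witness₈ (hGZK : rank_eq_analyticRank_of_analyticRank_le_one)
    (hCT : WeierstrassCurve.exists_casselsTate_pairing (K := ℚ)) (hr : W.analyticRank ≤ 1)
    (h2 : Nat.card (AddSubgroup.torsionBy W.sha 2) = 4)
    (hdiv : ∀ z : W.sha, 2 • z = 0 → ∃ w : W.sha, 2 • w = z)
    (hdiv₄ : ∀ y : W.sha, 4 • y = 0 → ∃ x : W.sha, 2 • x = y)
    (hx : ∃ x : W.sha, 8 • x = 0 ∧ ¬ ∃ w : W.sha, 2 • w = x)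
    {q : ℚ} (hq : shaAn W = (q : ℂ)) (hv : padicValRat 2 q = 6) : BSDp W 2 := by
  haveI : Finite W.sha := (hGZK W hr).2
  obtain ⟨B, halt, horth⟩ := sha_orthogonal_two_of_casselsTate W hCT
  obtain ⟨x, hx8, hx2⟩ := hx
  have hbit : ∃ x y : W.sha, 8 • x = 0 ∧ 2 • y = 0 ∧ B x y ≠ 0 := by
    by_contra h
    exact hx2 (horth x fun y hy => Classical.by_contradiction fun hB => h ⟨x, y, hx8, hy, hB⟩)
  exact X5.bsdp_two_of_pairing_bit₈ W hGZK hr B halt h2 hdiv hdiv₄ hbit hq hv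

/-- Arithmetic side condition `4 ∣ 2·2` for `[2]_* : Sel^(4) → Sel^(2)` (content-free private
helper). [folklore] -/
private theorem four_dvd₈ : (4 : ℤ) ∣ 2 * 2 := by norm_num

/-- Arithmetic side condition `8 ∣ 4·2` for `[2]_* : Sel^(8) → Sel^(4)` (content-free private
helper). [folklore] -/
private theorem eight_dvd₈ : (8 : ℤ) ∣ 4 * 2 := by norm_num

/-- Arithmetic side condition `16 ∣ 8·2` for `[2]_* : Sel^(16) → Sel^(8)` (content-free private
helper). [folklore] -/
private theorem sixteen_dvd₈ : (16 : ℤ) ∣ 8 * 2 := by norm_num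

omit [W.IsGloballyMinimal] in
/-- **ITEM FORM at levels `8 | 16`, the load-bearing direction**: an `8`-Selmer class `s` NOT in
`[2]_* Sel^(16)(E/ℚ)` (no everywhere-locally-soluble `2`-covering of the `8`-covering `s`) has torsor
class `π₈(s)` NOT divisible by `2` in `Ш(E/ℚ)` — over the tree's Kummer–Selmer diagram:
`π₈([2]_* z) = 2·π₁₆(z)` (`selmerToSha_selmerZSMul`), `Sel^(16) ↠ Ш[16]` (`exists_selmerToSha_eq`),
`ker π₈ ⊆ [2]_* Sel^(16)` (`exists_selmerZSMul_eq_of_selmerToSha_eq_zero`). The levels-`4 | 8`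
version is `not_two_divisible_of_not_mem_range`. [cite: SilvermanAEC2009, §X.4, Thm. X.4.2(a); Stamminger2005, §1.3] -/
theorem X5.not_two_divisible_of_not_mem_selmer16 {s : W.selmerGroup 8}
    (hs : ¬ ∃ z : W.selmerGroup 16, W.selmerZSMul 2 sixteen_dvd₈ z = s) :
    ¬ ∃ w : W.sha, 2 • w = W.selmerToSha 8 s := by
  rintro ⟨w, hw⟩
  have h8 : 8 • W.selmerToSha 8 s = 0 := by
    have h := W.zsmul_selmerToSha 8 s
    rwa [ofNat_zsmul] at h
  have h16 : (16 : ℤ) • w = 0 := by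
    have e : (16 : ℕ) • w = 8 • (2 • w) := by rw [smul_smul]; norm_num
    rw [ofNat_zsmul, e, hw, h8]
  obtain ⟨z, hz⟩ := W.exists_selmerToSha_eq (n := 16) (by norm_num) w h16
  have hz' : W.selmerToSha 8 (s - W.selmerZSMul 2 sixteen_dvd₈ z) = 0 := by
    rw [map_sub, selmerToSha_selmerZSMul, ofNat_zsmul, hz, hw, sub_self]
  obtain ⟨z', hz''⟩ :
      ∃ z' : W.selmerGroup 16, W.selmerZSMul 2 sixteen_dvd₈ z' = s - W.selmerZSMul 2 sixteen_dvd₈ z :=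
    W.exists_selmerZSMul_eq_of_selmerToSha_eq_zero 2 (by norm_num) (by norm_num) _ hz'
  exact hs ⟨z' + z, by rw [map_add, hz'', sub_add_cancel]⟩

/-- **The lower-bound-only rows, ITEM form: `BSD(E, 2)` from ONE 8-Selmer class over the tree's
Selmer groups** (granted GZK and bsd.S18; nothing is claimed for any curve — `hs` is the OPEN input,
one item where `X5.bsdp_two_of_selmer_level3` asks mode S of every item): analytic rank `≤ 1`;
`#E(ℚ)[2] = 2^t`, `#Sel^(2)(E/ℚ) = 2^(r_an+t+2)` (`#Ш[2] = 4`); every 2-Selmer class lifts to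
`Sel^(4)` (`Ш[2] ⊆ 2Ш`); every 4-Selmer class lifts to `Sel^(8)` (`Ш[4] ⊆ 2Ш`); ONE
`s ∈ Sel^(8)(E/ℚ)` outside `[2]_* Sel^(16)(E/ℚ)`; `ord₂ #Ш_an = 6`.
[cite: SilvermanAEC2009, Thm. X.4.2(a), Thm. X.4.14; Cassels1962ArithmeticIV, Thm. 1.1; Cassels1998, §1; Stamminger2005, Thm. 6.2.2] -/
theorem X5.bsdp_two_of_selmer_item₈ (hGZK : rank_eq_analyticRank_of_analyticRank_le_one)
    (hCT : WeierstrassCurve.exists_casselsTate_pairing (K := ℚ)) (hr : W.analyticRank ≤ 1) {t : ℕ}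
    (ht : Nat.card (AddSubgroup.torsionBy W.toAffine.Point 2) = 2 ^ t)
    (hSel : Nat.card (W.selmerGroup 2) = 2 ^ (W.analyticRank + t + 2))
    (hF : ∀ s : W.selmerGroup 2, ∃ z : W.selmerGroup 4, W.selmerZSMul 2 four_dvd₈ z = s)
    (hF₄ : ∀ s : W.selmerGroup 4, ∃ z : W.selmerGroup 8, W.selmerZSMul 2 eight_dvd₈ z = s)
    {s : W.selmerGroup 8} (hs : ¬ ∃ z : W.selmerGroup 16, W.selmerZSMul 2 sixteen_dvd₈ z = s)
    {q : ℚ} (hq : shaAn W = (q : ℂ)) (hv : padicValRat 2 q = 6) : BSDp W 2 := by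
  have h2 := X5.card_sha_two_of_card_selmerTwo W (hGZK W hr).1 ht hSel
  have hdiv := X5.two_divisible_of_selmer_lift W hF
  have hdiv₄ := X5.four_torsion_two_divisible_of_selmer_lift₄ W hF₄
  have h8 : 8 • W.selmerToSha 8 s = 0 := by
    have h := W.zsmul_selmerToSha 8 s
    rwa [ofNat_zsmul] at h
  exact X5.bsdp_two_of_casselsTate_witness₈ W hGZK hCT hr h2 hdiv hdiv₄
    ⟨_, h8, X5.not_two_divisible_of_not_mem_selmer16 W hs⟩ hq hv

end Sha

end Literature.NumberTheory.EllipticCurves.Rank1Residual.Typed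

end
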